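import Mathlib
import Summits.Ventures.PercRepro.TriangleCapDiagonalGen

/-!
# PercRepro — THE STABILITY TABLE BELOW THE DIAGONAL FOR EVERY ROW, THE PIECES AT A GENERAL DISTANCE `r`: the
cap lemma for `r ≤ a − 3`, the convexity of the row `a + 1`, the cross-row deletion, the bipartite bound and the
within-row arithmetic (p3, gen 44; part 196a)

On the cell `(k, a, r)` — `m = a (k − a) − r` edges, `2a + r ≤ k` — the target at second order is
`Σ_v d(v)² + r (k − 1 − r) + 2 (k − 2a − 1)(a − r) ≤ m k` for every graph that is NOT `a`-bipartite (the gap `B2`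
of §10bt(c)). The pieces of part 195a generalise to every `r ≤ a − 3`:
* THE CAP (`below_cap_gen`): with `N = N(x)`, `|N| = K = k − a`, `M` the matching inside `N`, `R` the `a − 1`
  non-neighbours, `P = Σ_{u ∈ R} degIn N u`, `E = adjPairs R`: `2(a − 1)K − 2r = 2M + 2P + E`; the max-degree cap
  gives `P + E ≤ (a − 1)K`, one end per matching edge gives `P + (a − 1)M ≤ (a − 1)K`, so `(a − 3)M ≤ 2r`; an edge
  `u v` inside `R` would force `P_u + P_v ≤ K + 1` and hence `K + (a − 3)M ≤ 2r + 1 + 2M` — impossible for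
  `K ≥ 2r + 2` (`a ≥ 5`) or `K ≥ 4r + 2` (`a = 4`); with `E = 0` the count gives `(a − 2)M ≤ r`, so `M = 0` for
  `r ≤ a − 3`, and `D ⊆ K(N(x)ᶜ, N(x))`.
* THE CONVEXITY (`below_convex_gen`): every degree in `[a + 1, k − a − 1]` gives `Σd² + r(k−1−r) + k(k−2a−1) ≤ mk`.
* THE CROSS-ROW DELETION (`below_cross_gen`): a vertex `z` of degree `d` with `r + d ≤ a − 1`; the envelope of
  `D − z` for `k + r + d ≤ 3a + 2` (slack `e (e + c + 2d)`), the closed form on the cell `(k − 1, a + 1, t)`,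
  `t = k + r + d − 3a − 2`, beyond (slack `2t (a − d)`).
Axioms: standard.
-/

namespace PercRepro

namespace TriangleCap

namespace C047

open Finset

variable {V : Type*} [Fintype V] [DecidableEq V]

/-- The cap hypothesis on the cell `(k, a, r)`: `m + r = a (k − a)`, `a ≤ k` ⇒ `m + a² + r = a k`. -/
theorem below_cap_arith (a k m r : ℕ) (hk : a ≤ k) (hm : m + r = a * (k - a)) : m + a * a + r = a * k := by
  obtain ⟨t, rfl⟩ : ∃ t, k = a + t := ⟨k - a, by omega⟩
  rw [Nat.add_sub_cancel_left] at hm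
  nlinarith [hm]

/-- The count at the cap, step 1: `(a − 3) M ≤ 2r` (`a = a' + 4`). -/
theorem below_cap_count (a' K M P E m r : ℕ) (hdeg : K + (K + 2 * M + P) + (P + E) = 2 * m)
    (hm : m + r = (a' + 4) * K) (h1 : P + E ≤ (a' + 3) * K) (h2 : P + (a' + 3) * M ≤ (a' + 3) * K) :
    (a' + 1) * M ≤ 2 * r := by
  nlinarith [hdeg, hm, h1, h2]

/-- The count at the cap, step 2: an edge `u v` inside `R` (`P_u + P_v ≤ K + 1`, the other `a − 3` vertices at
`≤ K − M`) is impossible for `K ≥ 2r + 2` (`a ≥ 5`) or `K ≥ 4r + 2` (`a = 4`). -/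
theorem below_cap_noedge (a' K M P E m r Pu Pv Pr : ℕ) (hdeg : K + (K + 2 * M + P) + (P + E) = 2 * m)
    (hm : m + r = (a' + 4) * K) (h1 : P + E ≤ (a' + 3) * K) (hM1 : (a' + 1) * M ≤ 2 * r)
    (hPuv : Pu + Pv ≤ K + 1) (hrest : Pr + (a' + 1) * M ≤ (a' + 1) * K) (hP : P = Pu + Pv + Pr)
    (hK1 : 2 * r + 2 ≤ K) (hK2 : a' = 0 → 4 * r + 2 ≤ K) : False := by
  subst hP
  rcases Nat.eq_zero_or_pos a' with ha0 | ha1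
  · subst ha0
    have := hK2 rfl
    nlinarith [hdeg, hm, h1, hM1, hPuv, hrest]
  · have hMM : M ≤ a' * M := Nat.le_mul_of_pos_left M ha1
    nlinarith [hdeg, hm, h1, hM1, hPuv, hrest, hMM]

/-- The count at the cap, step 3: with no edge inside `R`, `(a − 2) M ≤ r`, so `M = 0` for `r ≤ a − 3`. -/
theorem below_cap_matching (a' K M P m r : ℕ) (hdeg : K + (K + 2 * M + P) + (P + 0) = 2 * m)
    (hm : m + r = (a' + 4) * K) (h2 : P + (a' + 3) * M ≤ (a' + 3) * K) (hr : r + 3 ≤ a' + 4) : M = 0 := by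
  by_contra hM
  have hM1 : 1 ≤ M := by omega
  have hMM : a' + 2 ≤ (a' + 2) * M := Nat.le_mul_of_pos_right (a' + 2) hM1
  nlinarith [hdeg, hm, h2, hMM]

/-- **THE CAP ON THE CELL `(k, a, r)` FOR `r ≤ a − 3`:** a `K₄⁻`-free graph with `a (k − a) − r` edges, `a ≥ 4`, `2a + r ≤ k`,
`k − a ≥ 2r + 2` (and `≥ 4r + 2` when `a = 4`), with a vertex `x` of degree `k − a`, is a spanning subgraph of
`K(N(x)ᶜ, N(x))`. -/
theorem below_cap_gen (D : SimpleGraph V) [DecidableRel D.Adj] (hK : K4mFree D) (a r : ℕ) (ha4 : 4 ≤ a)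
    (ha : r + 3 ≤ a) (hk : 2 * a + r ≤ Fintype.card V) (hm : D.edgeFinset.card + r = a * (Fintype.card V - a))
    (hK1 : 2 * r + 2 + a ≤ Fintype.card V) (hK2 : a = 4 → 4 * r + 2 + a ≤ Fintype.card V) (x : V)
    (hx : deg D x + a = Fintype.card V) :
    ∃ A : Finset V, A.card = a ∧ BipSub D A := by
  obtain ⟨N, hN⟩ : ∃ N : Finset V, N = univ.filter (fun w => D.Adj x w) := ⟨_, rfl⟩
  have hmemN : ∀ w, w ∈ N ↔ D.Adj x w := fun w => by rw [hN, mem_filter]; simp only [mem_univ, true_and]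
  have hxN : x ∉ N := fun h => D.irrefl ((hmemN x).mp h)
  have hdx : deg D x = N.card := by rw [hN]; rfl
  obtain ⟨K, hKdef⟩ : ∃ K, N.card = K := ⟨_, rfl⟩
  have hcardV : Fintype.card V = K + a := by omega
  obtain ⟨m, hmdef⟩ : ∃ m, D.edgeFinset.card = m := ⟨_, rfl⟩
  -- the max-degree cap: every degree is `≤ k − a`
  have hcap : ∀ v, deg D v + a ≤ Fintype.card V := fun v =>
    deg_add_le_card_of_dense D hK a (by omega) (by omega)
      (cap_arith a (Fintype.card V) D.edgeFinset.card r (by omega) hk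
        (below_cap_arith a (Fintype.card V) D.edgeFinset.card r (by omega) hm)) v
  rw [hmdef, hcardV, Nat.add_sub_cancel] at hm
  -- the non-neighbours `R`, `|R| = a − 1`
  obtain ⟨R, hR⟩ : ∃ R : Finset V, R = (insert x N)ᶜ := ⟨_, rfl⟩
  have hRcard : R.card + 1 = a := by
    rw [hR, card_compl, card_insert_of_notMem hxN]
    omega
  have hmemR : ∀ w, w ∈ R ↔ w ≠ x ∧ ¬ D.Adj x w := by
    intro w
    rw [hR, mem_compl, mem_insert, hmemN]
    tauto
  -- the matching inside `N`
  obtain ⟨M, hM⟩ : ∃ M, adjPairs D N = 2 * M := ⟨_, adjPairs_eq_two_mul D N⟩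
  have hTf : ∑ y ∈ N, degIn D N y = 2 * M := by rw [← adjPairs_eq_sum_degIn, hM]
  -- `P = Σ_{u ∈ R} degIn N u`, `E = adjPairs R`
  obtain ⟨P, hPdef⟩ : ∃ P, ∑ u ∈ R, degIn D N u = P := ⟨_, rfl⟩
  obtain ⟨E, hEdef⟩ : ∃ E, adjPairs D R = E := ⟨_, rfl⟩
  -- the degree sum over `{x} ∪ N ∪ R`
  have hsplit : ∀ F : V → ℕ, ∑ w, F w = F x + ∑ y ∈ N, F y + ∑ u ∈ R, F u := by
    intro F
    rw [← sum_add_sum_compl (insert x N), sum_insert hxN, ← hR]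
  have hsumN : ∑ y ∈ N, deg D y = K + 2 * M + P := by
    have h : ∀ y ∈ N, deg D y = 1 + degIn D N y + degIn D R y := by
      intro y hy
      have := deg_eq_of_mem_nbhd D x y ((hmemN y).mp hy)
      rw [← hN, ← hR] at this
      exact this
    rw [sum_congr rfl h, sum_add_distrib, sum_add_distrib, sum_const, smul_eq_mul, mul_one, hKdef, hTf,
      sum_degIn_comm D N R, hPdef]
  have hdegR : ∀ u ∈ R, deg D u = degIn D N u + degIn D R u := by
    intro u hu
    have := deg_eq_of_not_mem_nbhd D x u ((hmemR u).mp hu).2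
    rw [← hN, ← hR] at this
    exact this
  have hsumR : ∑ u ∈ R, deg D u = P + E := by
    rw [sum_congr rfl hdegR, sum_add_distrib, hPdef, ← adjPairs_eq_sum_degIn, hEdef]
  have hdegsum := sum_deg_eq D
  rw [hsplit, hsumN, hsumR, hdx, hKdef, hmdef] at hdegsum
  -- (1) every vertex of `R` has degree `≤ K`
  have h1 : P + E ≤ (a - 1) * K := by
    rw [← hsumR]
    calc ∑ u ∈ R, deg D u ≤ ∑ _u ∈ R, K := sum_le_sum (fun u _ => by have := hcap u; omega)
      _ = (a - 1) * K := by rw [sum_const, smul_eq_mul]; congr 1; omega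
  -- (2) every vertex of `R` has at most `K − M` neighbours in `N` (one end of each matching edge)
  have hPle : ∀ u ∈ R, degIn D N u + M ≤ K := by
    intro u hu
    have := two_mul_degIn_add_adjPairs_le D hK (x := x) ((hmemR u).mp hu).1
    rw [← hN, hM, hKdef] at this
    omega
  have h2 : P + (a - 1) * M ≤ (a - 1) * K := by
    have hs : ∑ u ∈ R, (degIn D N u + M) ≤ ∑ _u ∈ R, K := sum_le_sum hPle
    rw [sum_add_distrib, sum_const, sum_const, smul_eq_mul, smul_eq_mul, hPdef] at hs
    have e : R.card = a - 1 := by omega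
    rw [e] at hs
    exact hs
  obtain ⟨a', rfl⟩ : ∃ a', a = a' + 4 := ⟨a - 4, by omega⟩
  have e1 : a' + 4 - 1 = a' + 3 := by omega
  rw [e1] at h1 h2
  have hK1' : 2 * r + 2 ≤ K := by omega
  have hK2' : a' = 0 → 4 * r + 2 ≤ K := fun h => by have := hK2 (by omega); omega
  -- (3) `(a − 3) M ≤ 2r`
  have hM1 : (a' + 1) * M ≤ 2 * r := below_cap_count a' K M P E m r hdegsum hm h1 h2
  -- (4) no edge inside `R`
  have hE0 : E = 0 := by
    by_contra hE
    -- an edge `u v` inside `R`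
    obtain ⟨u, hu, hu1⟩ : ∃ u ∈ R, 1 ≤ degIn D R u := by
      by_contra hcon
      push Not at hcon
      have h0 : ∑ u ∈ R, degIn D R u = 0 := sum_eq_zero (fun u hu => by have := hcon u hu; omega)
      rw [← adjPairs_eq_sum_degIn, hEdef] at h0
      exact hE h0
    obtain ⟨v, hv, huv⟩ : ∃ v ∈ R, D.Adj u v := by
      unfold degIn at hu1
      obtain ⟨v, hv⟩ := card_pos.mp hu1
      rw [mem_filter] at hv
      exact ⟨v, hv.1, hv.2⟩
    have hne : u ≠ v := D.ne_of_adj huv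
    have hPuv : degIn D N u + degIn D N v ≤ K + 1 := by
      have := degIn_add_degIn_le_of_adj_pair D hK N huv
      rw [hKdef] at this
      exact this
    -- the other `a − 3` vertices of `R`
    have hvR' : v ∈ R.erase u := mem_erase.mpr ⟨hne.symm, hv⟩
    have hsum1 := add_sum_erase R (fun w => degIn D N w) hu
    have hsum2 := add_sum_erase (R.erase u) (fun w => degIn D N w) hvR'
    have hcard2 : ((R.erase u).erase v).card = a' + 1 := by
      rw [card_erase_of_mem hvR', card_erase_of_mem hu]
      omega
    have hrest : ∑ w ∈ (R.erase u).erase v, degIn D N w + (a' + 1) * M ≤ (a' + 1) * K := by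
      have hs : ∑ w ∈ (R.erase u).erase v, (degIn D N w + M) ≤ ∑ _w ∈ (R.erase u).erase v, K :=
        sum_le_sum (fun w hw => hPle w (mem_of_mem_erase (mem_of_mem_erase hw)))
      rw [sum_add_distrib, sum_const, sum_const, smul_eq_mul, smul_eq_mul, hcard2] at hs
      exact hs
    obtain ⟨Pu, hPu⟩ : ∃ Pu, degIn D N u = Pu := ⟨_, rfl⟩
    obtain ⟨Pv, hPv⟩ : ∃ Pv, degIn D N v = Pv := ⟨_, rfl⟩
    obtain ⟨Pr, hPr⟩ : ∃ Pr, ∑ w ∈ (R.erase u).erase v, degIn D N w = Pr := ⟨_, rfl⟩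
    rw [hPu, hPv] at hPuv
    rw [hPu, hPdef] at hsum1
    rw [hPv, hPr] at hsum2
    rw [hPr] at hrest
    exact below_cap_noedge a' K M P E m r Pu Pv Pr hdegsum hm h1 hM1 hPuv hrest
      (by rw [← hsum1, ← hsum2]; ring) hK1' hK2'
  -- (5) `M = 0`
  have hM0 : M = 0 := below_cap_matching a' K M P m r (by rw [hE0] at hdegsum; exact hdegsum) hm h2 (by omega)
  -- no edge inside `N`, none inside `R`
  have hnoN : ∀ y ∈ N, ∀ y', D.Adj y y' → y' ∉ N := by
    intro y hy y' hyy' hy'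
    have h0 : degIn D N y = 0 := by
      have hle : degIn D N y ≤ ∑ z ∈ N, degIn D N z := single_le_sum (fun _ _ => Nat.zero_le _) hy
      rw [hTf, hM0, mul_zero] at hle
      exact Nat.le_zero.mp hle
    unfold degIn at h0
    rw [card_eq_zero, filter_eq_empty_iff] at h0
    exact h0 hy' hyy'
  have hnoR : ∀ u ∈ R, ∀ u', D.Adj u u' → u' ∉ R := by
    intro u hu u' huu' hu'
    have h0 : degIn D R u = 0 := by
      have hle : degIn D R u ≤ ∑ z ∈ R, degIn D R z := single_le_sum (fun _ _ => Nat.zero_le _) hu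
      rw [← adjPairs_eq_sum_degIn, hEdef, hE0] at hle
      exact Nat.le_zero.mp hle
    unfold degIn at h0
    rw [card_eq_zero, filter_eq_empty_iff] at h0
    exact h0 hu' huu'
  -- `D ⊆ K(Nᶜ, N)`
  refine ⟨Nᶜ, ?_, ?_⟩
  · rw [card_compl, hKdef]
    omega
  · intro p q hpq
    rw [mem_compl, mem_compl, not_not]
    constructor
    · intro hpN
      by_contra hqN
      by_cases hpx : p = x
      · subst hpx
        exact hqN ((hmemN q).mpr hpq)
      by_cases hqx : q = x
      · subst hqx
        exact hpN ((hmemN p).mpr (D.adj_symm hpq))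
      have hpR : p ∈ R := (hmemR p).mpr ⟨hpx, fun h => hpN ((hmemN p).mpr h)⟩
      have hqR : q ∈ R := (hmemR q).mpr ⟨hqx, fun h => hqN ((hmemN q).mpr h)⟩
      exact hnoR p hpR q hpq hqR
    · intro hqN hpN
      exact hnoN p hpN q hpq hqN

omit [DecidableEq V] in
/-- **EVERY DEGREE IN `[a + 1, k − a − 1]` ON THE CELL `(k, a, r)`:** `Σ_v d(v)² + r (k − 1 − r) + k (k − 2a − 1) ≤ m k`
for `m + r = a (k − a)`, `r ≤ a`, `2a + 1 ≤ k`. -/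
theorem below_convex_gen (D : SimpleGraph V) [DecidableRel D.Adj] (a r : ℕ) (hr : r ≤ a)
    (hk : 2 * a + 1 ≤ Fintype.card V) (hm : D.edgeFinset.card + r = a * (Fintype.card V - a))
    (hcap : ∀ v, deg D v + a + 1 ≤ Fintype.card V) (hdeg : ∀ v, a + 1 ≤ deg D v) :
    ∑ v, deg D v * deg D v + r * (Fintype.card V - 1 - r) + Fintype.card V * (Fintype.card V - 2 * a - 1) ≤
      D.edgeFinset.card * Fintype.card V := by
  have hsum : ∑ v, (deg D v * deg D v + (a + 1) * (Fintype.card V - a - 1)) ≤ ∑ v, Fintype.card V * deg D v :=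
    sum_le_sum (fun v _ => convex_vertex_gen (deg D v) (Fintype.card V) a (hdeg v) (hcap v))
  rw [sum_add_distrib, sum_const, card_univ, smul_eq_mul, ← mul_sum, sum_deg_eq] at hsum
  obtain ⟨k, hk'⟩ : ∃ k, Fintype.card V = k := ⟨_, rfl⟩
  obtain ⟨S, hS⟩ : ∃ S, ∑ v, deg D v * deg D v = S := ⟨_, rfl⟩
  obtain ⟨m, hmdef⟩ : ∃ m, D.edgeFinset.card = m := ⟨_, rfl⟩
  rw [hk'] at hsum hm hk
  rw [hS, hmdef] at hsum
  rw [hmdef] at hm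
  rw [hS, hk', hmdef]
  obtain ⟨q, rfl⟩ : ∃ q, a = r + q := ⟨a - r, by omega⟩
  obtain ⟨t, rfl⟩ : ∃ t, k = 2 * (r + q) + 1 + t := ⟨k - (2 * (r + q) + 1), by omega⟩
  have e1 : 2 * (r + q) + 1 + t - (r + q) - 1 = r + q + t := by omega
  have e2 : 2 * (r + q) + 1 + t - 2 * (r + q) - 1 = t := by omega
  have e3 : 2 * (r + q) + 1 + t - (r + q) = r + q + 1 + t := by omega
  have e4 : 2 * (r + q) + 1 + t - 1 - r = r + 2 * q + t := by omega
  rw [e1] at hsum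
  rw [e3] at hm
  rw [e2, e4]
  nlinarith [hsum, hm]

/-- The cross-row arithmetic in the envelope regime, `k + r + d < 3a + 2` (parametrised `a = c + r + d + e`,
`k = 2a + 2 + c`, `k + r + d + e = 3a + 2`): the slack is `e (e + c + 2d)`. -/
theorem below_cross_env (a r d k m' S' T : ℕ) (hk : 2 * a + 2 ≤ k) (hsmall : k + r + d < 3 * a + 2)
    (hmd : m' + d + r = a * (k - a)) (henv : S' ≤ m' * (k - 1)) (hT : T ≤ d * (k - a - 2)) :
    S' + 2 * T + d + d * d + r * (k - 1 - r) + 2 * (k - 2 * a - 1) * (a - r) ≤ (m' + d) * k := by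
  obtain ⟨c, hc⟩ : ∃ c, k = 2 * a + 2 + c := ⟨k - (2 * a + 2), by omega⟩
  obtain ⟨e, he⟩ : ∃ e, k + r + d + e = 3 * a + 2 := ⟨3 * a + 2 - (k + r + d), by omega⟩
  obtain rfl : a = c + r + d + e := by omega
  subst hc
  have e1 : 2 * (c + r + d + e) + 2 + c - 1 = 2 * (c + r + d + e) + 1 + c := by omega
  have e2 : 2 * (c + r + d + e) + 2 + c - (c + r + d + e) - 2 = c + r + d + e + c := by omega
  have e3 : 2 * (c + r + d + e) + 2 + c - 2 * (c + r + d + e) - 1 = c + 1 := by omega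
  have e4 : 2 * (c + r + d + e) + 2 + c - (c + r + d + e) = c + r + d + e + 2 + c := by omega
  have e5 : 2 * (c + r + d + e) + 2 + c - 1 - r = 3 * c + r + 2 * d + 2 * e + 1 := by omega
  have e6 : c + r + d + e - r = c + d + e := by omega
  rw [e1] at henv
  rw [e2] at hT
  rw [e4] at hmd
  rw [e3, e5, e6]
  nlinarith [henv, hT, hmd, Nat.zero_le (e * (e + c + 2 * d))]

/-- The side conditions of the closed form on the cell `(k − 1, a + 1, t)`, `t = k + r + d − 3a − 2`
(`r + d + 1 ≤ a`, `3a + 2 ≤ k + r + d`): `2 (a + 1) + t ≤ k − 1` and `m' + (a + 1)² + t = (a + 1)(k − 1)`. -/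
theorem below_cross_cell_side (a r d k m' : ℕ) (hz : r + d + 1 ≤ a) (hlarge : 3 * a + 2 ≤ k + r + d)
    (hmd : m' + d + r = a * (k - a)) :
    2 * (a + 1) + (k + r + d - (3 * a + 2)) ≤ k - 1 ∧
      m' + (a + 1) * (a + 1) + (k + r + d - (3 * a + 2)) = (a + 1) * (k - 1) := by
  obtain ⟨t, ht⟩ : ∃ t, k + r + d = 3 * a + 2 + t := ⟨k + r + d - (3 * a + 2), by omega⟩
  obtain ⟨b, hb⟩ : ∃ b, a = d + r + 1 + b := ⟨a - (d + r + 1), by omega⟩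
  subst hb
  obtain rfl : k = 2 * d + 2 * r + 3 * b + 5 + t := by omega
  have e0 : 2 * d + 2 * r + 3 * b + 5 + t - (d + r + 1 + b) = d + r + 2 * b + 4 + t := by omega
  have e1 : 2 * d + 2 * r + 3 * b + 5 + t + r + d - (3 * (d + r + 1 + b) + 2) = t := by omega
  have e2 : 2 * d + 2 * r + 3 * b + 5 + t - 1 = 2 * d + 2 * r + 3 * b + 4 + t := by omega
  rw [e0] at hmd
  rw [e1, e2]
  constructor
  · omega
  · nlinarith [hmd]

/-- The cross-row arithmetic in the closed-form regime (parametrised `a = d + r + 1 + b`,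
`k = 2d + 2r + 3b + 5 + t`): the slack is `2t (a − d)`. -/
theorem below_cross_cell (a r d k m' S' T : ℕ) (hz : r + d + 1 ≤ a) (hlarge : 3 * a + 2 ≤ k + r + d)
    (hmd : m' + d + r = a * (k - a))
    (hcell : S' + (k + r + d - (3 * a + 2)) * (k - 1 - 1 - (k + r + d - (3 * a + 2))) ≤ m' * (k - 1))
    (hT : T ≤ d * (k - a - 2)) :
    S' + 2 * T + d + d * d + r * (k - 1 - r) + 2 * (k - 2 * a - 1) * (a - r) ≤ (m' + d) * k := by
  obtain ⟨t, ht⟩ : ∃ t, k + r + d = 3 * a + 2 + t := ⟨k + r + d - (3 * a + 2), by omega⟩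
  obtain ⟨b, hb⟩ : ∃ b, a = d + r + 1 + b := ⟨a - (d + r + 1), by omega⟩
  subst hb
  obtain rfl : k = 2 * d + 2 * r + 3 * b + 5 + t := by omega
  have e0 : 2 * d + 2 * r + 3 * b + 5 + t - (d + r + 1 + b) = d + r + 2 * b + 4 + t := by omega
  have e1 : 2 * d + 2 * r + 3 * b + 5 + t + r + d - (3 * (d + r + 1 + b) + 2) = t := by omega
  have e2 : 2 * d + 2 * r + 3 * b + 5 + t - 1 - 1 - t = 2 * d + 2 * r + 3 * b + 3 := by omega
  have e3 : 2 * d + 2 * r + 3 * b + 5 + t - 1 = 2 * d + 2 * r + 3 * b + 4 + t := by omega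
  have e4 : 2 * d + 2 * r + 3 * b + 5 + t - (d + r + 1 + b) - 2 = d + r + 2 * b + 2 + t := by omega
  have e5 : 2 * d + 2 * r + 3 * b + 5 + t - 2 * (d + r + 1 + b) - 1 = b + 2 + t := by omega
  have e6 : 2 * d + 2 * r + 3 * b + 5 + t - 1 - r = 2 * d + r + 3 * b + 4 + t := by omega
  have e7 : d + r + 1 + b - r = d + 1 + b := by omega
  rw [e0] at hmd
  rw [e1, e2, e3] at hcell
  rw [e4] at hT
  rw [e5, e6, e7]
  nlinarith [hcell, hT, hmd, Nat.zero_le (t * (b + r + 1))]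

/-- **THE CROSS-ROW CASE ON THE CELL `(k, a, r)`:** `m + r = a (k − a)`, `3 ≤ a`, `2a + 2 ≤ k`, every degree
`≤ k − a − 1`, a vertex `z` of degree `d` with `r + d + 1 ≤ a` ⇒ `Σ_v d(v)² + r (k − 1 − r) + 2 (k − 2a − 1)(a − r) ≤ m k`. -/
theorem below_cross_gen (D : SimpleGraph V) [DecidableRel D.Adj] (hK : K4mFree D) (a r : ℕ) (ha : 3 ≤ a)
    (hk : 2 * a + 2 ≤ Fintype.card V) (hm : D.edgeFinset.card + r = a * (Fintype.card V - a))
    (hcap : ∀ v, deg D v + a + 1 ≤ Fintype.card V) (z : V) (hz : r + deg D z + 1 ≤ a) :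
    ∑ v, deg D v * deg D v + r * (Fintype.card V - 1 - r) + 2 * (Fintype.card V - 2 * a - 1) * (a - r) ≤
      D.edgeFinset.card * Fintype.card V := by
  have hK' := k4mFree_del D hK z
  have hcard' := card_del z
  have hedges' := card_edges_del D z
  have hsq := sum_deg_sq_del D z
  have hT := sum_del_nbhd_le D z (Fintype.card V - a - 2) (fun v => by have := hcap v; omega)
  obtain ⟨d, hd⟩ : ∃ d, deg D z = d := ⟨_, rfl⟩
  rw [hd] at hz hedges' hsq hT
  obtain ⟨T, hTdef⟩ : ∃ T, ∑ w : {v : V // v ≠ z}, (if D.Adj w.1 z then deg (del D z) w else 0) = T := ⟨_, rfl⟩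
  rw [hTdef] at hsq hT
  obtain ⟨S', hS'def⟩ : ∃ S', ∑ w : {v : V // v ≠ z}, deg (del D z) w * deg (del D z) w = S' := ⟨_, rfl⟩
  rw [hS'def] at hsq
  obtain ⟨m', hm'def⟩ : ∃ m', (del D z).edgeFinset.card = m' := ⟨_, rfl⟩
  rw [hm'def] at hedges'
  obtain ⟨k, hk'⟩ : ∃ k, Fintype.card V = k := ⟨_, rfl⟩
  have hk'' : Fintype.card {v : V // v ≠ z} = k - 1 := by omega
  rw [hk'] at hk hm hT ⊢
  have hmd : m' + d + r = a * (k - a) := by rw [hedges', hm]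
  rw [hsq, ← hedges']
  clear hsq hTdef hd
  rcases Nat.lt_or_ge (k + r + d) (3 * a + 2) with hsmall | hlarge
  · -- the envelope regime
    have henv := sum_deg_sq_le_of_k4mFree (del D z) hK' (by omega)
    rw [hS'def, hm'def, hk''] at henv
    exact below_cross_env a r d k m' S' T hk hsmall hmd henv hT
  · -- the closed-form regime: `D − z` on the cell `(k − 1, a + 1, t)`
    obtain ⟨hc2, hc3⟩ := below_cross_cell_side a r d k m' hz hlarge hmd
    rw [← hk''] at hc2 hc3
    rw [← hm'def] at hc3
    have hcell := closed_form_stability (del D z) hK' (a + 1) (k + r + d - (3 * a + 2)) (by omega) hc2 hc3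
    rw [hS'def, hm'def, hk''] at hcell
    exact below_cross_cell a r d k m' S' T hz hlarge hmd hcell hT

end C047

end TriangleCap

end PercRepro
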